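import Mathlib
import HarnessLib
import Literature.MathematicalPhysics.StatisticalMechanics.InitialActivityHamiltonianNorm
import Literature.MathematicalPhysics.StatisticalMechanics.PolymerFactorisationDifference

/-!
# [ABKM19] Lemma 12.2 (`j₁ = 1`, `j₂ = 0`) in Lipschitz form: the weak norm of
# `K̂_0(𝒦, ℋ) − K̂_0(𝒦', ℋ)` at scale `0` — Lipschitz dependence of the initial activity on the
# PERTURBATION `𝒦`

Continuation of `InitialActivityHamiltonianNorm.lean` (there: `j₁ = 0`, `j₂ ∈ {0,1}`, i.e. the size of
`K̂_0 = e^{−ℋ}𝒦` and its Lipschitz dependence on the relevant seed `ℋ`).  The smoothness half of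
[ABKM19] Theorem 2.2 (regular dependence of the free energy `𝒲_N` on the perturbation `𝒦`, via the
regular dependence of the tuned flow on its initial datum, Lemma 12.6 / Theorem 12.1) also needs the
derivative of `K̂_0` in `𝒦` ((12.9) with `j₁ = 1`): in difference form, for `C^{r₀}` complex
perturbations with `‖D^s𝒦'(z)‖ ≤ ρe^{|z|²/4}` and `‖D^s(𝒦 − 𝒦')(z)‖ ≤ εe^{|z|²/4}` (`s ≤ r₀`),

* `tayNormLE_initK_sub` — `|∏_{x∈X}𝒦(∇φ(x)) − ∏_{x∈X}𝒦'(∇φ(x))|_{T_φ} ≤ (((ρ+ε)e^{𝔥/R})^{|X|} −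
  (ρe^{𝔥/R})^{|X|}) e^{¼Σ_{x∈X}|∇φ(x)|²}` (site-by-site telescoping, `tayNormLE_prod_sub_prod`, with the
  single-site entry estimate of Lemma 12.3);
* **`weakNormLE_initKH_sub_pert`** — `‖K̂_0(𝒦, ℋ) − K̂_0(𝒦', ℋ)‖_0^{(A)} ≤ e^{1/4}e^{𝔥_0}A · ε` for
  `‖ℋ‖_{0,0} ≤ ⅛`, when `e^{1/4}(ρ+ε)e^{𝔥_0}A ≤ ½` (Lemma 9.3 for `e^{−ℋ}` on the blocks, the product
  estimate, the scale-`0` weight inequality of Lemma 12.5, and `(n+1)xⁿ ≤ 1` for `x ≤ ½`).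

This is the hypothesis "`‖y₀^{p}(h) − y₀^{p'}(h)‖_0 ≤ m_p`" (`m_p = e^{1/4}e^{𝔥_0}A·‖𝒦 − 𝒦'‖`) of the
fixed-point comparison `RGFlow.norm_initial_sub_le_of_isTunedQ`
(`Literature/Dynamics/Hyperbolic/RGFlowStableManifoldSecondFixedPointLipschitz`).  Everything is
proved; no named fact.

## References
* S. Adams, S. Buchholz, R. Kotecký, S. Müller, arXiv:1910.13564, Lemma 12.2 (12.9)–(12.10),
  Lemma 12.3 (12.17)–(12.18), Lemma 12.5, Lemma 9.3 [AdamsBuchholzKoteckyMuller2019].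
-/

noncomputable section

namespace Literature.MathematicalPhysics.StatisticalMechanics.GradientRG

open scoped BigOperators Classical
open Finset Matrix
open Literature.MathematicalPhysics.StatisticalMechanics.TorusPolymer
  (IsPolymer blocks bprod blockOf thicken numBlocks mem_blocks subset_thicken thicken_mono
    isPolymer_empty card_blocks_eq_numBlocks)
open Literature.Barriers.CriticalPhenomena.LongRangePhi4.Polymer (IsConn)
open Literature.MathematicalPhysics.QuantumFieldTheory

variable {d M : ℕ} [NeZero M]

/-! ## The difference of the site products (Lemma 12.3 in difference form) -/

/-- **`|∏_{x∈X}𝒦(∇·(x)) − ∏_{x∈X}𝒦'(∇·(x))|_{T_φ} ≤ (((ρ+ε)e^{𝔥/R})^{|X|} − (ρe^{𝔥/R})^{|X|})·e^{¼Σ_{x∈X}|∇φ(x)|²}`**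
for `X ⊆ S` (gauge `T_{𝔥,R,p,S}`), `‖D^s𝒦'(z)‖ ≤ ρe^{|z|²/4}`, `‖D^s(𝒦−𝒦')(z)‖ ≤ εe^{|z|²/4}` (`s ≤ r₀`).
[cite: AdamsBuchholzKoteckyMuller2019, Lemma 12.3 (12.18)] -/
theorem tayNormLE_initK_sub {r₀ : ℕ} {ρ ε : ℝ} {𝒦 𝒦' : (Fin d → ℝ) → ℂ}
    (h𝒦 : ContDiff ℝ r₀ 𝒦) (h𝒦' : ContDiff ℝ r₀ 𝒦')
    (h𝒦'b : ∀ k, k ≤ r₀ → ∀ z : Fin d → ℝ, ‖iteratedFDeriv ℝ k 𝒦' z‖ ≤ ρ * Real.exp ((∑ i, z i ^ 2) / 4))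
    (hΔb : ∀ k, k ≤ r₀ → ∀ z : Fin d → ℝ,
      ‖iteratedFDeriv ℝ k (fun z => 𝒦 z - 𝒦' z) z‖ ≤ ε * Real.exp ((∑ i, z i ^ 2) / 4))
    {𝔥 R : ℝ} (h𝔥 : 0 < 𝔥) (hR : 0 < R) {p : ℕ} (hp : 1 ≤ p) {S X : Finset (Fin d → ZMod M)}
    (hXS : X ⊆ S) :
    TayNormLE (fieldGauge 𝔥 R p S) r₀ (fun φ => Real.exp ((∑ x ∈ X, ∑ i, (gradAt x φ i) ^ 2) / 4))
      (fun φ => initK 𝒦 X φ - initK 𝒦' X φ)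
      (((ρ + ε) * Real.exp (𝔥 / R)) ^ X.card - (ρ * Real.exp (𝔥 / R)) ^ X.card) := by
  have hρ : 0 ≤ ρ := by
    have h0 := (norm_nonneg _).trans (h𝒦'b 0 (Nat.zero_le _) 0)
    exact (mul_nonneg_iff_of_pos_right (Real.exp_pos _)).1 h0
  have hε : 0 ≤ ε := by
    have h0 := (norm_nonneg _).trans (hΔb 0 (Nat.zero_le _) 0)
    exact (mul_nonneg_iff_of_pos_right (Real.exp_pos _)).1 h0
  have hΔd : ContDiff ℝ r₀ (fun z => 𝒦 z - 𝒦' z) := h𝒦.sub h𝒦'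
  -- per-site data
  have hK' : ∀ x ∈ X, TayNormLE (fieldGauge 𝔥 R p S) r₀
      (fun φ => Real.exp ((∑ y ∈ ({x} : Finset (Fin d → ZMod M)), ∑ i, (gradAt y φ i) ^ 2) / 4))
      (initK 𝒦' {x}) (ρ * Real.exp (𝔥 / R)) := by
    intro x hx φ
    have h := tayNorm_initK_le (M := M) h𝒦' h𝒦'b h𝔥 hR hp (Finset.singleton_subset_iff.2 (hXS hx)) φ
    rw [Finset.card_singleton, pow_one] at h
    exact h
  have hΔ : ∀ x ∈ X, TayNormLE (fieldGauge 𝔥 R p S) r₀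
      (fun φ => Real.exp ((∑ y ∈ ({x} : Finset (Fin d → ZMod M)), ∑ i, (gradAt y φ i) ^ 2) / 4))
      (fun φ => initK 𝒦 {x} φ - initK 𝒦' {x} φ) (ε * Real.exp (𝔥 / R)) := by
    intro x hx φ
    have h := tayNorm_initK_le (M := M) hΔd hΔb h𝔥 hR hp (Finset.singleton_subset_iff.2 (hXS hx)) φ
    rw [Finset.card_singleton, pow_one] at h
    have e : (fun φ => initK 𝒦 {x} φ - initK 𝒦' {x} φ) = initK (M := M) (fun z => 𝒦 z - 𝒦' z) {x} := by
      funext ψ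
      simp [initK, Finset.prod_singleton]
    rw [e]
    exact h
  have hmain := tayNormLE_prod_sub_prod (T := fieldGauge 𝔥 R p S) (Ti := fun _ => fieldGauge 𝔥 R p S)
    (wi := fun x φ => Real.exp ((∑ y ∈ ({x} : Finset (Fin d → ZMod M)), ∑ i, (gradAt y φ i) ^ 2) / 4))
    (Ki := fun x => initK 𝒦 {x}) (Ki' := fun x => initK 𝒦' {x})
    (c := fun _ => ρ * Real.exp (𝔥 / R)) (ρ := fun _ => ε * Real.exp (𝔥 / R))
    (w := fun φ => Real.exp ((∑ x ∈ X, ∑ i, (gradAt x φ i) ^ 2) / 4)) X hK' hΔ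
    (fun _ _ _ => le_rfl) (fun x _ => contDiff_initK h𝒦 {x}) (fun x _ => contDiff_initK h𝒦' {x})
    (fun x hx => isGaugeLocal_initK 𝒦 h𝔥 hR hp (Finset.singleton_subset_iff.2 (hXS hx)))
    (fun x hx => isGaugeLocal_initK 𝒦' h𝔥 hR hp (Finset.singleton_subset_iff.2 (hXS hx)))
    (fun _ _ => mul_nonneg hρ (Real.exp_pos _).le) (fun _ _ => mul_nonneg hε (Real.exp_pos _).le)
    (fun φ => by
      rw [← Real.exp_sum, ← Finset.sum_div]
      simp only [Finset.sum_singleton]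
      exact le_rfl)
  have hfun : (fun φ => ∏ x ∈ X, initK 𝒦 {x} φ - ∏ x ∈ X, initK 𝒦' {x} φ)
      = fun φ => initK (M := M) 𝒦 X φ - initK 𝒦' X φ := by
    funext φ
    simp [initK, Finset.prod_singleton]
  have hconst : (∏ _x ∈ X, (ρ * Real.exp (𝔥 / R) + ε * Real.exp (𝔥 / R))) - ∏ _x ∈ X, ρ * Real.exp (𝔥 / R)
      = ((ρ + ε) * Real.exp (𝔥 / R)) ^ X.card - (ρ * Real.exp (𝔥 / R)) ^ X.card := by
    rw [Finset.prod_const, Finset.prod_const, ← add_mul]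
  rw [hfun, hconst] at hmain
  exact hmain

/-! ## [ABKM19] Lemma 12.2 with `j₁ = 1`: Lipschitz dependence of `K̂_0(𝒦, ℋ)` on `𝒦` -/

/-- **[ABKM19] Lemma 12.2 (`j₁ = 1`, `j₂ = 0`) for the torus data, Lipschitz form.**  Under the data
hypotheses of `weakNormLE_initKH`, for `C^{r₀}` complex perturbations `𝒦, 𝒦'` with
`‖D^s𝒦'(z)‖ ≤ ρe^{|z|²/4}`, `‖D^s(𝒦 − 𝒦')(z)‖ ≤ εe^{|z|²/4}` (`s ≤ r₀`), a relevant seed with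
`‖ℋ‖_{0,0} ≤ ⅛`, and the smallness `e^{1/4}(ρ+ε)e^{𝔥_0}A ≤ ½`:
`‖K̂_0(𝒦, ℋ) − K̂_0(𝒦', ℋ)‖_0^{(A)} ≤ e^{1/4}e^{𝔥_0}A · ε`.  On a connected polymer `X` with `|X| = n+1`:
`|e^{−ℋ(X)}(∏𝒦 − ∏𝒦')|_{T_φ} ≤ (e^{1/4})^{n+1}W_0^X·(((ρ+ε)^{n+1} − ρ^{n+1})e^{𝔥_0(n+1)})w_{−1:0}^X ≤
e^{1/4}e^{𝔥_0}ε·(n+1)(e^{1/4}(ρ+ε)e^{𝔥_0})ⁿ w_0^X ≤ e^{1/4}e^{𝔥_0}Aε · A^{−|X|} w_0^X`.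
[cite: AdamsBuchholzKoteckyMuller2019, Lemma 12.2 (12.9)] -/
theorem weakNormLE_initKH_sub_pert {L N Mord R n p r₀ : ℕ} {θbar lam μ δ₁ δ₀ A𝒫 h A : ℝ}
    {𝒞 : ℕ → (Fin d → ZMod M) → ℝ} (hd : 2 ≤ d) (hLodd : Odd L) (hM : M = L ^ N)
    (hp : d / 2 + 1 ≤ p) (hMord : d / 2 + 1 ≤ Mord)
    (hB : AbkmWeightBounds L N Mord R n θbar lam μ δ₁ δ₀ A𝒫 𝒞
      (abkmWeightData L N Mord R θbar (schedDelta δ₀ δ₁ N) 𝒞))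
    (hδ₀ : 0 < δ₀) (hδ₁ : 0 < δ₁) (hh : 0 < h) (hh0 : hZeroSq d R δ₀ δ₁ ≤ h ^ 2) (hA : 0 < A)
    {𝒦 𝒦' : (Fin d → ℝ) → ℂ} {ρ ε : ℝ} (h𝒦 : ContDiff ℝ r₀ 𝒦) (h𝒦' : ContDiff ℝ r₀ 𝒦')
    (h𝒦'b : ∀ k, k ≤ r₀ → ∀ z : Fin d → ℝ, ‖iteratedFDeriv ℝ k 𝒦' z‖ ≤ ρ * Real.exp ((∑ i, z i ^ 2) / 4))
    (hΔb : ∀ k, k ≤ r₀ → ∀ z : Fin d → ℝ,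
      ‖iteratedFDeriv ℝ k (fun z => 𝒦 z - 𝒦' z) z‖ ≤ ε * Real.exp ((∑ i, z i ^ 2) / 4))
    {H : RelevantHamiltonian ℂ d}
    (hH : hamNorm (fieldWt h (L : ℝ) d 0) ((L : ℝ) ^ 0) (L ^ (d * 0)) H ≤ 1 / 8)
    (hsmall : Real.exp (1 / 4) * ((ρ + ε) * Real.exp (fieldWt h (L : ℝ) d 0 / (L : ℝ) ^ 0)) * A ≤ 1 / 2) :
    WeakNormLE (abkmNormParams L N Mord R p r₀ h θbar A (schedDelta δ₀ δ₁ N) 𝒞) 0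
      (initKH 𝒦 H - initKH 𝒦' H)
      (Real.exp (1 / 4) * Real.exp (fieldWt h (L : ℝ) d 0 / (L : ℝ) ^ 0) * A * ε) := by
  set P := abkmNormParams L N Mord R p r₀ h θbar A (schedDelta δ₀ δ₁ N) 𝒞 with hP
  set W := abkmWeightData L N Mord R θbar (schedDelta δ₀ δ₁ N) 𝒞 with hW
  set eh := Real.exp (fieldWt h (L : ℝ) d 0 / (L : ℝ) ^ 0) with heh
  have hL0 : (0 : ℝ) < L := by exact_mod_cast hLodd.pos
  have h𝔥 : 0 < fieldWt h (L : ℝ) d 0 := fieldWt_pos hh hL0 d 0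
  have hR0 : (0 : ℝ) < (L : ℝ) ^ 0 := by positivity
  have hp1 : 1 ≤ p := le_trans (by omega) hp
  have hρ : 0 ≤ ρ := by
    have h0 := (norm_nonneg _).trans (h𝒦'b 0 (Nat.zero_le _) 0)
    exact (mul_nonneg_iff_of_pos_right (Real.exp_pos _)).1 h0
  have hε : 0 ≤ ε := by
    have h0 := (norm_nonneg _).trans (hΔb 0 (Nat.zero_le _) 0)
    exact (mul_nonneg_iff_of_pos_right (Real.exp_pos _)).1 h0
  have heh0 : 0 < eh := Real.exp_pos _
  have hMt : M = L ^ 0 * L ^ N := by rw [pow_zero, one_mul]; exact hM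
  have hsodd : Odd (L ^ 0) := hLodd.pow
  have htodd : Odd (L ^ N) := hLodd.pow
  set a := Real.exp (1 / 4) with hadef
  have ha0 : 0 ≤ a := (Real.exp_pos _).le
  -- strong family
  set G : ℕ → Finset (Fin d → ZMod M) → Matrix (Fin d → ZMod M) (Fin d → ZMod M) ℝ :=
    fun j Y => strongCoef h N j • derivForm (L : ℝ) j (diffIndex d Mord)
      (boxDensity (boxRad R L j) (boxWt (L : ℝ) d j) Y) with hG
  have hGs : W.StrongDominated G fun _ X Y => Disjoint X Y :=
    hB.strong (diffIndex d Mord) (fun α hα => hα) (strongCoef h N) (strongCoef_le hδ₀ hδ₁ hh hh0)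
  intro X hX hXc
  have hX' : IsPolymer (L ^ 0) X := hX
  have hm : 1 ≤ X.card := Finset.card_pos.2 hXc.1
  have hcard : ∀ x : Fin d → ZMod M, (blockOf (L ^ 0) x).card = L ^ (d * 0) := fun x => by
    rw [TorusPolymer.card_blockOf hMt hsodd htodd x, ← pow_mul, mul_comm]
  have hgauge : ∀ Y ⊆ X, ∀ ξ, ‖P.gauge 0 Y ξ‖ ≤ ‖P.gauge 0 X ξ‖ := fun Y hY ξ =>
    norm_fieldGauge_mono_set _ _ _ (thicken_mono _ hY) ξ
  -- the Boltzmann factor on the blocks (Lemma 9.3)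
  have hF : ∀ B ∈ blocks (L ^ 0) X,
      TayNormLE (P.gauge 0 B) r₀ (expWeight (G 0 B)) (expNegH H B) a := by
    intro B hBm
    obtain ⟨x, -, rfl⟩ := mem_blocks.1 hBm
    have hH' : hamNorm (fieldWt h (L : ℝ) d 0) ((L : ℝ) ^ 0) (blockOf (L ^ 0) x).card H ≤ 1 / 8 := by
      rw [hcard x]; exact hH
    exact tayNormLE_expNegH_strong_abkm (R := R) (N := N) (Mord := Mord) hd hLodd hM (Nat.zero_le N) hh
      hMord hp (subset_thicken (P.rad 0) (blockOf (L ^ 0) x)) r₀ hH'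
  have hFd : ∀ B ∈ blocks (L ^ 0) X, ContDiff ℝ r₀ (expNegH H B) := fun B _ =>
    (contDiff_eval H B (n := r₀)).neg.cexp
  have hFloc : ∀ B ∈ blocks (L ^ 0) X, IsGaugeLocal (P.gauge 0 B) (expNegH H B) := fun B _ =>
    isGaugeLocal_cexp_neg_eval h𝔥.ne' hR0.ne' hp (subset_thicken _ _) H
  have hleb : ∀ B ∈ blocks (L ^ 0) X, ∀ ξ, ‖P.gauge 0 B ξ‖ ≤ ‖P.gauge 0 X ξ‖ := fun B hBm =>
    hgauge B (hX'.subset_of_mem_blocks hBm)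
  have haB : ∀ B ∈ blocks (L ^ 0) X, (0 : ℝ) ≤ a := fun _ _ => ha0
  have h1 := tayNormLE_bprod (L ^ 0) (P.gauge 0 X) (fun B => P.gauge 0 B) X hF hleb hFd hFloc haB
  have hKeq : (fun φ : (Fin d → ZMod M) → ℝ => bprod (L ^ 0) (fun B => expNegH H B φ) X) = expNegH H X :=
    funext fun φ => bprod_cexp_neg_eval H hX' φ
  have hWeq : (fun φ : (Fin d → ZMod M) → ℝ => ∏ B ∈ blocks (L ^ 0) X, expWeight (G 0 B) φ) =
      expWeight (G 0 X) :=
    funext fun φ => prod_expWeight_blocks hGs 0 (L ^ 0) hX' φ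
  have hCeq : ∏ _B ∈ blocks (L ^ 0) X, a = a ^ X.card := by
    rw [Finset.prod_const, card_blocks_pow_zero]
  rw [hKeq, hWeq, hCeq] at h1
  -- the difference of the initial activities (Lemma 12.3, difference form)
  have h2 := tayNormLE_initK_sub (M := M) h𝒦 h𝒦' h𝒦'b hΔb h𝔥 hR0 hp1 (subset_thicken (starRad R L d 0) X)
  -- the product
  have hXd : ContDiff ℝ r₀ (expNegH H X) := (contDiff_eval H X (n := r₀)).neg.cexp
  have hXloc : IsGaugeLocal (P.gauge 0 X) (expNegH H X) :=
    isGaugeLocal_cexp_neg_eval h𝔥.ne' hR0.ne' hp (subset_thicken _ _) H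
  have hΔd : ContDiff ℝ r₀ (fun φ => initK (M := M) 𝒦 X φ - initK 𝒦' X φ) :=
    (contDiff_initK h𝒦 X).sub (contDiff_initK h𝒦' X)
  have hΔloc : IsGaugeLocal (P.gauge 0 X) (fun φ => initK (M := M) 𝒦 X φ - initK 𝒦' X φ) :=
    IsGaugeLocal.op₂ _ (fun u v : ℂ => u - v) (isGaugeLocal_initK 𝒦 h𝔥 hR0 hp1 (subset_thicken _ _))
      (isGaugeLocal_initK 𝒦' h𝔥 hR0 hp1 (subset_thicken _ _))
  have hw : ∀ φ, expWeight (G 0 X) φ * Real.exp ((∑ x ∈ X, ∑ i, (gradAt x φ i) ^ 2) / 4) ≤ W.weight 0 X φ := by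
    intro φ
    rw [mul_comm]
    exact exp_quarter_mul_expWeight_le_weight_zero (strongCoef_le hδ₀ hδ₁ hh hh0 0) X φ
  have hC0 : 0 ≤ ((ρ + ε) * eh) ^ X.card - (ρ * eh) ^ X.card :=
    sub_nonneg.2 (pow_le_pow_left₀ (mul_nonneg hρ heh0.le)
      (mul_le_mul_of_nonneg_right (le_add_of_nonneg_right hε) heh0.le) _)
  have h3 := TayNormLE.mul (T := P.gauge 0 X) (w := W.weight 0 X) h1 h2 (fun ξ => le_rfl) (fun ξ => le_rfl)
    hXd hΔd hXloc hΔloc (pow_nonneg ha0 _) hC0 hw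
  have hfun : expNegH H X * (fun φ => initK (M := M) 𝒦 X φ - initK 𝒦' X φ) =
      (initKH 𝒦 H - initKH 𝒦' H : Finset (Fin d → ZMod M) → ((Fin d → ZMod M) → ℝ) → ℂ) X := by
    funext φ
    simp only [Pi.mul_apply, Pi.sub_apply]
    rw [initKH_apply, initKH_apply]
    ring
  rw [hfun] at h3
  refine h3.mono ?_ fun φ => (W.weight_pos 0 X φ).le
  -- the constant
  have haF : P.aFactor 0 X = (A ^ X.card)⁻¹ := by
    show (A ^ numBlocks (L ^ 0) X)⁻¹ = _
    rw [numBlocks_pow_zero]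
  rw [haF, ← div_eq_mul_inv, le_div_iff₀ (pow_pos hA _)]
  obtain ⟨k, hk⟩ : ∃ k, X.card = k + 1 := ⟨X.card - 1, by omega⟩
  rw [hk]
  have hx0 : 0 ≤ a * ((ρ + ε) * eh) * A := by positivity
  have hkey := succ_mul_pow_le_one_of_le_half hx0 hsmall k
  have hkey' : (k + 1 : ℝ) * (a ^ k * ((ρ + ε) * eh) ^ k * A ^ k) ≤ 1 := by
    rw [← mul_pow, ← mul_pow]; exact hkey
  have hmv : ((ρ + ε) * eh) ^ (k + 1) - (ρ * eh) ^ (k + 1) ≤ (k + 1 : ℝ) * (ε * eh) * ((ρ + ε) * eh) ^ k := by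
    have h := Literature.MathematicalPhysics.StatisticalMechanics.TorusPolymer.add_pow_succ_sub_pow_succ_le
      (mul_nonneg hρ heh0.le) (mul_nonneg hε heh0.le) k
    have e1 : ρ * eh + ε * eh = (ρ + ε) * eh := by ring
    rw [e1] at h
    have e : ε * eh * ((k + 1 : ℕ) : ℝ) * ((ρ + ε) * eh) ^ k = (k + 1 : ℝ) * (ε * eh) * ((ρ + ε) * eh) ^ k := by
      push_cast; ring
    rw [e] at h
    exact h
  calc a ^ (k + 1) * (((ρ + ε) * eh) ^ (k + 1) - (ρ * eh) ^ (k + 1)) * A ^ (k + 1)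
      ≤ a ^ (k + 1) * ((k + 1 : ℝ) * (ε * eh) * ((ρ + ε) * eh) ^ k) * A ^ (k + 1) :=
        mul_le_mul_of_nonneg_right (mul_le_mul_of_nonneg_left hmv (pow_nonneg ha0 _)) (pow_nonneg hA.le _)
    _ = a * eh * A * ε * ((k + 1 : ℝ) * (a ^ k * ((ρ + ε) * eh) ^ k * A ^ k)) := by ring
    _ ≤ a * eh * A * ε * 1 := mul_le_mul_of_nonneg_left hkey' (by positivity)
    _ = a * eh * A * ε := by ring

end Literature.MathematicalPhysics.StatisticalMechanics.GradientRG

end
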